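import Summits.FinalStateConjecture.FinalStateConjecture.Theses.ZeroEnergyKerrOrBomb
import Literature.Geometry.Lorentzian.IdealPoints
import Literature.Geometry.Lorentzian.StaticBlackHoleUniquenessProofs
import Literature.Geometry.Lorentzian.SubdevelopmentCausalConvexity
import Literature.Geometry.Lorentzian.OpensCausality
import Literature.Geometry.Lorentzian.CausalityPushUp

/-!
# `ZeroEnergyRigidity`, line `global-horizon-killing-field` — stub `stub_futurePresentation`,
# part A: causal structure of an open sub-spacetime which no causal curve leaves

Support file for crux `stmt-FinalStateConjecture-10690`
(`Summit.FinalStateConjecture.FinalStateConjecture.Theses.ZeroEnergyKerrOrBomb.ZeroEnergyRigidity`),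
stub S1b `stub_futurePresentation` (WLOG the carrier of a presentation is `I⁺(M_ext)`).  The
re-presentation lives on the open sub-spacetime `(U, g|_U, τ|_U)` (`LorentzianMetric.restrict`,
`TimeOrientation.restrict`) of an open subset `U ⊆ M` which **no causal curve leaves** (every
future causal curve of `M` starting in `U` stays in `U`; `U = I⁺(M_ext)` is such a set by push-up).
For such `U` the causal relations of the sub-spacetime are computed in `M`:

* `isFutureCausalCurveOn_restrict_iff` — causal curves of `U` are the causal curves of `M` lying in
  `U` (`T_p U = T_p M`; the timelike version is `isFutureTimelikeCurveOn_restrict_iff` of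
  `OpensCausality`), and `exists_curve_lift` — an ambient segment inside `U` is (near each of its
  parameters) a curve of `U`;
* `chronologicalFuture_restrict_eq_preimage`, `chronologicalPast_restrict_eq_preimage`,
  `causalFuture_restrict_singleton_eq_preimage`, `causalPast_restrict_singleton_eq_preimage`,
  `causalDiamond_restrict_eq_preimage` — `I^±_U(A) = ι⁻¹ I^±(ι A)`, `J^±_U(p) = ι⁻¹ J^±(p)`;
* `isGloballyHyperbolic_restrict` — global hyperbolicity (causal, compact diamonds) passes to `U`.

References: B. O'Neill, *Semi-Riemannian geometry* (1983), Ch. 1, pp. 3–7 (open submanifolds),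
Ch. 14, p. 402 and Cor. 14.1; S. W. Hawking, G. F. R. Ellis (1973), §6.5–6.6 (causally convex
sets, global hyperbolicity); J. M. Lee, *Introduction to Smooth Manifolds* (2013), Prop. 3.9.
-/

noncomputable section

-- `Summit.FinalStateConjecture.FinalStateConjecture.…`: summit = problem name (D-0017).
set_option linter.dupNamespace false

namespace Summit.FinalStateConjecture.FinalStateConjecture.Theorems.ZeroEnergyRigidity.GlobalHorizonKillingField.FuturePresentation

open Set Function Filter TopologicalSpace Bundle Literature.Geometry.Lorentzian
open LorentzianMetric (subset_causalFuture chronologicalFuture_mono chronologicalPast_mono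
  mem_chronologicalFuture_of_mem_chronologicalPast mem_chronologicalPast_of_mem_chronologicalFuture
  mem_causalPast_singleton_iff isFutureTimelikeCurveOn_restrict_iff)
open scoped Manifold ContDiff Topology

/-! ## Causal structure of an open sub-spacetime which no causal curve leaves -/

section Opens

variable {E : Type*} [NormedAddCommGroup E] [NormedSpace ℝ E] {H : Type*} [TopologicalSpace H]
  {I : ModelWithCorners ℝ E H} {n : ℕ∞ω} {M : Type*} [TopologicalSpace M] [ChartedSpace H M]
  [IsManifold I ∞ M]

omit [IsManifold I ∞ M] in
/-- **Lift of an ambient curve segment into an open subset containing it**: a curve `γ` of `M`,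
continuous on `[a, b]` with `γ([a, b]) ⊆ U`, is, near every parameter of `[a, b]`, the composite
of a curve `δ` of `U` with the inclusion (take `δ = γ` where `γ ∈ U` and a constant elsewhere;
`U` is open). Lee 2013, Prop. 3.9. [folklore] -/
theorem exists_curve_lift (U : Opens M) {γ : ℝ → M} {a b : ℝ} (hab : a ≤ b)
    (hcont : ∀ t ∈ Icc a b, ContinuousAt γ t) (hγU : ∀ t ∈ Icc a b, γ t ∈ U) :
    ∃ δ : ℝ → U, (∀ t ∈ Icc a b, (δ t : M) = γ t) ∧
      ∀ t ∈ Icc a b, (Subtype.val ∘ δ) =ᶠ[𝓝 t] γ := by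
  classical
  have ha : a ∈ Icc a b := left_mem_Icc.2 hab
  refine ⟨fun t ↦ if h : γ t ∈ U then ⟨γ t, h⟩ else ⟨γ a, hγU a ha⟩, fun t ht ↦ by
    simp only [dif_pos (hγU t ht)], fun t ht ↦ ?_⟩
  have hmem : γ ⁻¹' (U : Set M) ∈ 𝓝 t :=
    (hcont t ht).preimage_mem_nhds (U.2.mem_nhds (hγU t ht))
  filter_upwards [hmem] with t' ht'
  simp only [comp_apply, dif_pos (show γ t' ∈ U from ht')]

omit [IsManifold I ∞ M] in
/-- The range of the inclusion of an open subset. [folklore] -/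
theorem range_val_opens (U : Opens M) : range (Subtype.val : U → M) = (U : Set M) :=
  Subtype.range_coe_subtype

omit [IsManifold I ∞ M] in
/-- For `K ⊆ U`, `ι(ι⁻¹ K) = K` along the inclusion `ι : U → M`. [folklore] -/
theorem image_val_preimage_val_of_subset (U : Opens M) {K : Set M} (hK : K ⊆ U) :
    Subtype.val '' (Subtype.val ⁻¹' K : Set U) = K :=
  image_preimage_eq_of_subset (by rw [range_val_opens]; exact hK)

omit [ChartedSpace H M] [IsManifold I ∞ M] in
/-- A compact subset of `M` contained in the open subset `U` is compact in `U`. [folklore] -/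
theorem isCompact_preimage_val_of_subset (U : Opens M) {K : Set M} (hK : K ⊆ U)
    (hKc : IsCompact K) : IsCompact (Subtype.val ⁻¹' K : Set U) := by
  rw [Topology.IsEmbedding.subtypeVal.isCompact_iff, image_val_preimage_val_of_subset U hK]
  exact hKc

omit [ChartedSpace H M] [IsManifold I ∞ M] in
/-- **Frontiers are computed in the ambient space**: for an open subset `U`,
`∂_U(ι⁻¹ A) = ι⁻¹(∂ A)` (the inclusion is a continuous open map). [folklore] -/
theorem frontier_preimage_val (U : Opens M) (A : Set M) :
    frontier (Subtype.val ⁻¹' A : Set U) = Subtype.val ⁻¹' frontier A :=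
  ((U.2.isOpenMap_subtype_val).preimage_frontier_eq_frontier_preimage continuous_subtype_val A).symm

variable {g : LorentzianMetric I n M} {τ : TimeOrientation g}

/-- A curve which agrees with a future timelike curve near every parameter of `s` is a future
timelike curve on `s` (same points, same velocities). O'Neill 1983, Ch. 14, p. 402. [folklore] -/
theorem isFutureTimelikeCurveOn_congr_of_eventuallyEq {γ γ' : ℝ → M} {s : Set ℝ}
    (hγ : g.IsFutureTimelikeCurveOn τ γ s) (h : ∀ t ∈ s, γ' =ᶠ[𝓝 t] γ) :
    g.IsFutureTimelikeCurveOn τ γ' s := by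
  intro t ht
  obtain ⟨hd, h1, h2⟩ := hγ t ht
  have hpt : γ' t = γ t := (h t ht).eq_of_nhds
  have hv : velocity I γ' t = velocity I γ t := DFunLike.congr_fun (h t ht).mfderiv_eq (1 : ℝ)
  have key : ∀ (p q : M), p = q → ∀ v : E,
      (g.IsTimelike (x := q) v → g.IsTimelike (x := p) v) ∧
        (τ.IsFutureDirected (x := q) v → τ.IsFutureDirected (x := p) v) := by
    rintro p q rfl v
    exact ⟨id, id⟩
  refine ⟨(h t ht).mdifferentiableAt_iff.2 hd, ?_, ?_⟩
  · rw [hv]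
    exact (key (γ' t) (γ t) hpt (velocity I γ t)).1 h1
  · rw [hv]
    exact (key (γ' t) (γ t) hpt (velocity I γ t)).2 h2

/-- A curve which agrees with a future causal curve near every parameter of `s` is a future
causal curve on `s`. O'Neill 1983, Ch. 14, p. 402. [folklore] -/
theorem isFutureCausalCurveOn_congr_of_eventuallyEq {γ γ' : ℝ → M} {s : Set ℝ}
    (hγ : g.IsFutureCausalCurveOn τ γ s) (h : ∀ t ∈ s, γ' =ᶠ[𝓝 t] γ) :
    g.IsFutureCausalCurveOn τ γ' s := by
  intro t ht
  obtain ⟨hd, h2⟩ := hγ t ht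
  have hpt : γ' t = γ t := (h t ht).eq_of_nhds
  have hv : velocity I γ' t = velocity I γ t := DFunLike.congr_fun (h t ht).mfderiv_eq (1 : ℝ)
  have key : ∀ (p q : M), p = q → ∀ v : E,
      τ.IsFutureDirected (x := q) v → τ.IsFutureDirected (x := p) v := by
    rintro p q rfl v
    exact id
  refine ⟨(h t ht).mdifferentiableAt_iff.2 hd, ?_⟩
  rw [hv]
  exact key (γ' t) (γ t) hpt (velocity I γ t) h2

variable (g τ) (hres : PseudoRiemannianMetric.contMDiff_restrict (I := I) (n := n) (M := M))
  (hτ : τ.contMDiff_restrict) (U : Opens M)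

/-- **A curve in an open sub-spacetime is a future causal curve there iff it is one in the
ambient spacetime** (`T_p U = T_p M`, same metric and time orientation at the point, same
velocity; the timelike version is `isFutureTimelikeCurveOn_restrict_iff` of `OpensCausality`).
O'Neill 1983, Ch. 1, pp. 3–7. [folklore] -/
theorem isFutureCausalCurveOn_restrict_iff {γ : ℝ → U} {s : Set ℝ} :
    (g.restrict hres U).IsFutureCausalCurveOn (τ.restrict hres hτ U) γ s ↔
      g.IsFutureCausalCurveOn τ (Subtype.val ∘ γ) s := by
  refine forall₂_congr fun t _ ↦ ?_
  have hv := velocity_subtypeVal_comp (I := I) U γ t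
  change (MDifferentiableAt 𝓘(ℝ, ℝ) I γ t ∧
      (g.val (γ t).1 (velocity I γ t) (velocity I γ t) ≤ 0 ∧ (velocity I γ t : E) ≠ 0) ∧
        g.val (γ t).1 (τ.vectorField (γ t).1) (velocity I γ t) < 0) ↔
    (MDifferentiableAt 𝓘(ℝ, ℝ) I (Subtype.val ∘ γ) t ∧
      (g.val (γ t).1 (velocity I (Subtype.val ∘ γ) t) (velocity I (Subtype.val ∘ γ) t) ≤ 0 ∧
          (velocity I (Subtype.val ∘ γ) t : E) ≠ 0) ∧
        g.val (γ t).1 (τ.vectorField (γ t).1) (velocity I (Subtype.val ∘ γ) t) < 0)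
  rw [mdifferentiableAt_subtypeVal_comp_curve_iff, hv]
  exact Iff.rfl

/-- `ι(I⁺_U(A)) ⊆ I⁺(ι A)`: the inclusion of an open sub-spacetime maps timelike curves to timelike
curves. O'Neill 1983, Ch. 14, p. 402. [folklore] -/
theorem image_val_chronologicalFuture_restrict_subset (A : Set U) :
    Subtype.val '' (g.restrict hres U).chronologicalFuture (τ.restrict hres hτ U) A ⊆
      g.chronologicalFuture τ (Subtype.val '' A) := by
  rintro _ ⟨q, ⟨p, hp, γ, a, b, hab, hγ, hpa, hqb⟩, rfl⟩
  exact ⟨p, mem_image_of_mem _ hp, Subtype.val ∘ γ, a, b, hab,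
    (isFutureTimelikeCurveOn_restrict_iff g τ hres hτ U).1 hγ,
    by rw [comp_apply, hpa], by rw [comp_apply, hqb]⟩

/-- `ι(I⁻_U(A)) ⊆ I⁻(ι A)` (time dual). O'Neill 1983, Ch. 14, p. 402. [folklore] -/
theorem image_val_chronologicalPast_restrict_subset (A : Set U) :
    Subtype.val '' (g.restrict hres U).chronologicalPast (τ.restrict hres hτ U) A ⊆
      g.chronologicalPast τ (Subtype.val '' A) :=
  image_val_chronologicalFuture_restrict_subset g τ.reverse hres
    (τ.contMDiff_restrict_reverse hτ) U A

/-- `ι(J⁺_U(A)) ⊆ J⁺(ι A)`: the inclusion of an open sub-spacetime maps causal curves to causal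
curves. O'Neill 1983, Ch. 14, p. 402. [folklore] -/
theorem image_val_causalFuture_restrict_subset (A : Set U) :
    Subtype.val '' (g.restrict hres U).causalFuture (τ.restrict hres hτ U) A ⊆
      g.causalFuture τ (Subtype.val '' A) := by
  rintro _ ⟨q, hq | ⟨p, hp, γ, a, b, hab, hγ, hpa, hqb⟩, rfl⟩
  · exact Or.inl (mem_image_of_mem _ hq)
  · exact Or.inr ⟨p, mem_image_of_mem _ hp, Subtype.val ∘ γ, a, b, hab,
      (isFutureCausalCurveOn_restrict_iff g τ hres hτ U).1 hγ,
      by rw [comp_apply, hpa], by rw [comp_apply, hqb]⟩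

/-- `ι(J⁻_U(A)) ⊆ J⁻(ι A)` (time dual). O'Neill 1983, Ch. 14, p. 402. [folklore] -/
theorem image_val_causalPast_restrict_subset (A : Set U) :
    Subtype.val '' (g.restrict hres U).causalPast (τ.restrict hres hτ U) A ⊆
      g.causalPast τ (Subtype.val '' A) :=
  image_val_causalFuture_restrict_subset g τ.reverse hres (τ.contMDiff_restrict_reverse hτ) U A

variable {U}

/-- In an open subset which no causal curve leaves, the causal future of a point of `U` lies in
`U`. Hawking–Ellis 1973, §6.5. [folklore] -/
theorem mem_opens_of_mem_causalFuture
    (hU : ∀ ⦃γ : ℝ → M⦄ ⦃a b : ℝ⦄, a < b → g.IsFutureCausalCurveOn τ γ (Icc a b) → γ a ∈ U →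
      ∀ t ∈ Icc a b, γ t ∈ U) {p r : M} (hp : p ∈ U) (hr : r ∈ g.causalFuture τ {p}) :
    r ∈ U := by
  rcases hr with hr | ⟨_, rfl, γ, a, b, hab, hγ, hpa, hrb⟩
  · rw [mem_singleton_iff] at hr
    exact hr ▸ hp
  · exact hrb ▸ hU hab hγ (hpa ▸ hp) b ⟨hab.le, le_rfl⟩

/-- **In an open sub-spacetime which no causal curve leaves, chronological futures are computed
in the ambient spacetime**: if every future causal curve of `M` starting in `U` stays in `U`,
then `I⁺_U(A) = ι⁻¹(I⁺(ι A))` for `A ⊆ U`. O'Neill 1983, Ch. 14, p. 402; Hawking–Ellis 1973, §6.5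
(causally convex sets). [folklore] -/
theorem chronologicalFuture_restrict_eq_preimage
    (hU : ∀ ⦃γ : ℝ → M⦄ ⦃a b : ℝ⦄, a < b → g.IsFutureCausalCurveOn τ γ (Icc a b) → γ a ∈ U →
      ∀ t ∈ Icc a b, γ t ∈ U) (A : Set U) :
    (g.restrict hres U).chronologicalFuture (τ.restrict hres hτ U) A =
      Subtype.val ⁻¹' g.chronologicalFuture τ (Subtype.val '' A) := by
  refine Subset.antisymm
    (fun q hq ↦ image_val_chronologicalFuture_restrict_subset g τ hres hτ U A ⟨q, hq, rfl⟩) ?_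
  rintro q ⟨_, ⟨p, hp, rfl⟩, γ, a, b, hab, hγ, hpa, hqb⟩
  have hγU : ∀ t ∈ Icc a b, γ t ∈ U := hU hab hγ.isFutureCausalCurveOn (hpa ▸ p.2)
  obtain ⟨δ, hδval, hδev⟩ :=
    exists_curve_lift U hab.le (fun t ht ↦ (hγ t ht).1.continuousAt) hγU
  refine ⟨p, hp, δ, a, b, hab, (isFutureTimelikeCurveOn_restrict_iff g τ hres hτ U).2
    (isFutureTimelikeCurveOn_congr_of_eventuallyEq hγ hδev), ?_, ?_⟩
  · exact Subtype.ext ((hδval a ⟨le_rfl, hab.le⟩).trans hpa)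
  · exact Subtype.ext ((hδval b ⟨hab.le, le_rfl⟩).trans hqb)

/-- **Chronological pasts of an open sub-spacetime which no causal curve leaves**:
`I⁻_U(A) = ι⁻¹(I⁻(ι A))` for `A ⊆ U` (a timelike curve of `M` from a point of `U` to a point of
`ι A` starts in `U`, hence stays in `U`). O'Neill 1983, Ch. 14, p. 402. [folklore] -/
theorem chronologicalPast_restrict_eq_preimage
    (hU : ∀ ⦃γ : ℝ → M⦄ ⦃a b : ℝ⦄, a < b → g.IsFutureCausalCurveOn τ γ (Icc a b) → γ a ∈ U →
      ∀ t ∈ Icc a b, γ t ∈ U) (A : Set U) :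
    (g.restrict hres U).chronologicalPast (τ.restrict hres hτ U) A =
      Subtype.val ⁻¹' g.chronologicalPast τ (Subtype.val '' A) := by
  refine Subset.antisymm
    (fun q hq ↦ image_val_chronologicalPast_restrict_subset g τ hres hτ U A ⟨q, hq, rfl⟩) ?_
  rintro q ⟨_, ⟨p, hp, rfl⟩, hqp⟩
  -- read the witnessing curve forwards: a timelike curve of `M` from `q ∈ U` to `p`
  have hpq : (p : M) ∈ g.chronologicalFuture τ {(q : M)} :=
    mem_chronologicalFuture_of_mem_chronologicalPast ⟨p, rfl, hqp⟩
  obtain ⟨_, hq', γ, a, b, hab, hγ, hqa, hpb⟩ := hpq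
  rw [mem_singleton_iff] at hq'
  subst hq'
  have hγU : ∀ t ∈ Icc a b, γ t ∈ U := hU hab hγ.isFutureCausalCurveOn (hqa ▸ q.2)
  obtain ⟨δ, hδval, hδev⟩ :=
    exists_curve_lift U hab.le (fun t ht ↦ (hγ t ht).1.continuousAt) hγU
  have hδt : (g.restrict hres U).IsFutureTimelikeCurveOn (τ.restrict hres hτ U) δ (Icc a b) :=
    (isFutureTimelikeCurveOn_restrict_iff g τ hres hτ U).2
      (isFutureTimelikeCurveOn_congr_of_eventuallyEq hγ hδev)
  have hpq' : p ∈ (g.restrict hres U).chronologicalFuture (τ.restrict hres hτ U) {q} :=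
    ⟨q, rfl, δ, a, b, hab, hδt, Subtype.ext ((hδval a ⟨le_rfl, hab.le⟩).trans hqa),
      Subtype.ext ((hδval b ⟨hab.le, le_rfl⟩).trans hpb)⟩
  exact chronologicalPast_mono (singleton_subset_iff.2 hp)
    (mem_chronologicalPast_of_mem_chronologicalFuture hpq')

/-- **Causal futures of points of an open sub-spacetime which no causal curve leaves**:
`J⁺_U(p) = ι⁻¹(J⁺(ι p))`. O'Neill 1983, Ch. 14, p. 402. [folklore] -/
theorem causalFuture_restrict_singleton_eq_preimage
    (hU : ∀ ⦃γ : ℝ → M⦄ ⦃a b : ℝ⦄, a < b → g.IsFutureCausalCurveOn τ γ (Icc a b) → γ a ∈ U →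
      ∀ t ∈ Icc a b, γ t ∈ U) (p : U) :
    (g.restrict hres U).causalFuture (τ.restrict hres hτ U) {p} =
      Subtype.val ⁻¹' g.causalFuture τ {(p : M)} := by
  refine Subset.antisymm (fun q hq ↦ ?_) ?_
  · have h := image_val_causalFuture_restrict_subset g τ hres hτ U {p} ⟨q, hq, rfl⟩
    rwa [image_singleton] at h
  rintro q (hq | ⟨_, hp', γ, a, b, hab, hγ, hpa, hqb⟩)
  · exact Or.inl (Subtype.ext hq)
  rw [mem_singleton_iff] at hp'
  subst hp'
  have hγU : ∀ t ∈ Icc a b, γ t ∈ U := hU hab hγ (hpa ▸ p.2)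
  obtain ⟨δ, hδval, hδev⟩ :=
    exists_curve_lift U hab.le (fun t ht ↦ (hγ t ht).1.continuousAt) hγU
  refine Or.inr ⟨p, rfl, δ, a, b, hab, (isFutureCausalCurveOn_restrict_iff g τ hres hτ U).2
    (isFutureCausalCurveOn_congr_of_eventuallyEq hγ hδev), ?_, ?_⟩
  · exact Subtype.ext ((hδval a ⟨le_rfl, hab.le⟩).trans hpa)
  · exact Subtype.ext ((hδval b ⟨hab.le, le_rfl⟩).trans hqb)

/-- **Causal pasts of points of an open sub-spacetime which no causal curve leaves**:
`J⁻_U(p) = ι⁻¹(J⁻(ι p))`. O'Neill 1983, Ch. 14, p. 402. [folklore] -/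
theorem causalPast_restrict_singleton_eq_preimage
    (hU : ∀ ⦃γ : ℝ → M⦄ ⦃a b : ℝ⦄, a < b → g.IsFutureCausalCurveOn τ γ (Icc a b) → γ a ∈ U →
      ∀ t ∈ Icc a b, γ t ∈ U) (p : U) :
    (g.restrict hres U).causalPast (τ.restrict hres hτ U) {p} =
      Subtype.val ⁻¹' g.causalPast τ {(p : M)} := by
  refine Subset.antisymm (fun q hq ↦ ?_) ?_
  · have h := image_val_causalPast_restrict_subset g τ hres hτ U {p} ⟨q, hq, rfl⟩
    rwa [image_singleton] at h
  intro q hq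
  -- `q ≤ p` in `M`: a causal curve of `M` from `q ∈ U` to `p`, which stays in `U`
  have hpq : (p : M) ∈ g.causalFuture τ {(q : M)} := mem_causalPast_singleton_iff.1 hq
  have hpq' : p ∈ (g.restrict hres U).causalFuture (τ.restrict hres hτ U) {q} := by
    rw [causalFuture_restrict_singleton_eq_preimage g τ hres hτ hU q]
    exact hpq
  exact mem_causalPast_singleton_iff.2 hpq'

/-- **Causal diamonds of an open sub-spacetime which no causal curve leaves are the ambient causal
diamonds**: `J⁺_U(p) ∩ J⁻_U(q) = ι⁻¹(J⁺(p) ∩ J⁻(q))`. Hawking–Ellis 1973, §6.5–6.6. [folklore] -/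
theorem causalDiamond_restrict_eq_preimage
    (hU : ∀ ⦃γ : ℝ → M⦄ ⦃a b : ℝ⦄, a < b → g.IsFutureCausalCurveOn τ γ (Icc a b) → γ a ∈ U →
      ∀ t ∈ Icc a b, γ t ∈ U) (p q : U) :
    (g.restrict hres U).causalFuture (τ.restrict hres hτ U) {p} ∩
        (g.restrict hres U).causalPast (τ.restrict hres hτ U) {q} =
      Subtype.val ⁻¹' (g.causalFuture τ {(p : M)} ∩ g.causalPast τ {(q : M)}) := by
  rw [causalFuture_restrict_singleton_eq_preimage g τ hres hτ hU,
    causalPast_restrict_singleton_eq_preimage g τ hres hτ hU, preimage_inter]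

variable (U) in
/-- **Causality is inherited by open sub-spacetimes**: a closed causal curve of `U` is a closed
causal curve of `M`. O'Neill 1983, Ch. 14, p. 407. [folklore] -/
theorem isCausallyWellBehaved_restrict (h : g.IsCausallyWellBehaved τ) :
    (g.restrict hres U).IsCausallyWellBehaved (τ.restrict hres hτ U) := by
  intro γ a b hab hγ heq
  exact h (Subtype.val ∘ γ) a b hab ((isFutureCausalCurveOn_restrict_iff g τ hres hτ U).1 hγ)
    (congrArg Subtype.val heq)

/-- **Global hyperbolicity passes to open sub-spacetimes which no causal curve leaves**: causality
is inherited, and the causal diamonds of `U` are the (compact) ambient diamonds, which lie in `U`.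
Hawking–Ellis 1973, §6.6; Bernal–Sánchez 2007, Thm. 3.2 (the definition used). [folklore] -/
theorem isGloballyHyperbolic_restrict
    (hU : ∀ ⦃γ : ℝ → M⦄ ⦃a b : ℝ⦄, a < b → g.IsFutureCausalCurveOn τ γ (Icc a b) → γ a ∈ U →
      ∀ t ∈ Icc a b, γ t ∈ U) (h : g.IsGloballyHyperbolic τ) :
    (g.restrict hres U).IsGloballyHyperbolic (τ.restrict hres hτ U) := by
  refine ⟨isCausallyWellBehaved_restrict g τ hres hτ U h.1, fun p q ↦ ?_⟩
  have hsub : g.causalFuture τ {(p : M)} ∩ g.causalPast τ {(q : M)} ⊆ U :=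
    fun r hr ↦ mem_opens_of_mem_causalFuture g τ hU p.2 hr.1
  rw [causalDiamond_restrict_eq_preimage g τ hres hτ hU p q]
  exact isCompact_preimage_val_of_subset U hsub (h.2 p q)

/-- **Registered sub-goal `stub_futurePresentation_opensGloballyHyperbolic`** (helper of stub S1b
`stub_futurePresentation`, crux `stmt-FinalStateConjecture-10690`): global hyperbolicity of a
presentation passes to any open sub-carrier which no causal curve leaves
(`isGloballyHyperbolic_restrict`). Hawking–Ellis 1973, §6.6. [folklore] -/
theorem stub_futurePresentation_opensGloballyHyperbolic :
    ∀ (𝓑 : StationaryAFBlackHole.{0}) (U : TopologicalSpace.Opens 𝓑.carrier),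
      (∀ ⦃γ : ℝ → 𝓑.carrier⦄ ⦃a b : ℝ⦄, a < b →
        𝓑.metric.IsFutureCausalCurveOn 𝓑.timeOrientation γ (Set.Icc a b) → γ a ∈ U →
          ∀ t ∈ Set.Icc a b, γ t ∈ U) →
      𝓑.metric.IsGloballyHyperbolic 𝓑.timeOrientation →
        (𝓑.metric.restrict PseudoRiemannianMetric.contMDiff_restrict_holds U).IsGloballyHyperbolic
          (𝓑.timeOrientation.restrict PseudoRiemannianMetric.contMDiff_restrict_holds
            𝓑.timeOrientation.contMDiff_restrict_holds U) :=
  fun 𝓑 U hU h ↦ isGloballyHyperbolic_restrict 𝓑.metric 𝓑.timeOrientation _ _ (U := U) hU h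

end Opens

end Summit.FinalStateConjecture.FinalStateConjecture.Theorems.ZeroEnergyRigidity.GlobalHorizonKillingField.FuturePresentation

end
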